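import Mathlib.Data.Finset.Sort
import Mathlib.Data.Fintype.Pigeonhole
import Literature.Computability.Complexity.CNF
import Literature.Computability.Complexity.CliqueTestGraphs
import HarnessLib

/-!
# The clique–colouring formulas

The CNF `Clique_{m,k}(x, q) ∧ Colour_{m,c}(x, r)` of the interpolation method (Krajíček 1997,
§7; Pudlák 1997, §3 (proof of Thm. 2); Krajíček 2019, §13.5 / §18.1): on the edge variables
`x_e` of the complete graph `K_m` (the input type `(⊤ : SimpleGraph (Fin m)).edgeSet` of the
tree's clique function, `CliqueTestGraphs.lean`), together with private variables
`q_{i,v}` ("the `i`-th clique vertex is `v`", `i < k`, `v < m`) and `r_{v,a}` ("vertex `v` gets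
colour `a`", `a < c`),

* `cliqueCNF m k` (the `A`-part) says that `q` describes `k` distinct vertices spanning a clique
  of the graph `x` — the edge variables occur only POSITIVELY;
* `colourCNF m c` (the `B`-part) says that `r` is a proper `c`-colouring of the graph `x` — the
  edge variables occur only negatively.

Variables are the three-sorted sum `Edge ⊕ ((Fin k × Fin m) ⊕ (Fin m × Fin c))` expected by
`ResolutionInterpolation.lean`.  Proved here: the graph of a `k`-set's clique vector satisfies
the `A`-part (`cliqueCNF_satOver_cliqueVec`), the complete multipartite graph of a `c`-colouring
satisfies the `B`-part (`colourCNF_satOver_colorVec`), the conjunction is unsatisfiable for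
`c < k` (`cliqueColourCNF_not_satisfiable`, pigeonhole), and the clause count is polynomial
(`length_cliqueColourCNF_le`).

## References

* J. Krajíček, J. Symbolic Logic 62 (1997), §7 (clique–colouring tautologies) [Krajicek1997].
* P. Pudlák, J. Symbolic Logic 62 (1997), §3 [Pudlak1997].
* J. Krajíček, *Proof complexity* (CUP 2019), §13.5 [KrajicekProofComplexity2019].
-/

namespace Literature.Computability.MetaComplexity

open Finset Literature.Computability.Complexity

namespace CliqueColouring

variable {m k c : ℕ}

/-- The variables of the clique–colouring formulas: edge variables of `K_m`, clique variables
`q_{i,v}` and colouring variables `r_{v,a}`. [cite: Krajicek1997, §7] -/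
abbrev Var (m k c : ℕ) : Type :=
  (⊤ : SimpleGraph (Fin m)).edgeSet ⊕ ((Fin k × Fin m) ⊕ (Fin m × Fin c))

/-- The edge variable of the distinct vertices `u ≠ v`. [cite: Krajicek1997, §7] -/
def edge {u v : Fin m} (h : u ≠ v) : Var m k c :=
  Sum.inl ⟨s(u, v), by simpa using h⟩

/-- The clique variable `q_{i,v}`: the `i`-th clique vertex is `v`. [cite: Krajicek1997, §7] -/
def q (i : Fin k) (v : Fin m) : Var m k c := Sum.inr (Sum.inl (i, v))

/-- The colouring variable `r_{v,a}`: vertex `v` gets colour `a`. [cite: Krajicek1997, §7] -/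
def r (v : Fin m) (a : Fin c) : Var m k c := Sum.inr (Sum.inr (v, a))

/-! ### The clique part `A(x, q)` -/

/-- Every clique position is occupied: `⋁_v q_{i,v}`. [cite: Krajicek1997, §7] -/
def cliquePos (m k c : ℕ) : CNF (Var m k c) :=
  (List.finRange k).map fun i => (List.finRange m).map fun v => (q i v, true)

/-- Distinct positions hold distinct vertices: `¬q_{i,v} ∨ ¬q_{j,v}` for `i ≠ j`.
[cite: Krajicek1997, §7] -/
def cliqueInj (m k c : ℕ) : CNF (Var m k c) :=
  (List.finRange k).flatMap fun i => (List.finRange k).flatMap fun j =>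
    (List.finRange m).flatMap fun v => if i = j then [] else [[(q i v, false), (q j v, false)]]

/-- The chosen vertices span a clique: `¬q_{i,u} ∨ ¬q_{j,v} ∨ x_{uv}` for `i ≠ j`, `u ≠ v`
(edge variables POSITIVE). [cite: Krajicek1997, §7] -/
def cliqueEdge (m k c : ℕ) : CNF (Var m k c) :=
  (List.finRange k).flatMap fun i => (List.finRange k).flatMap fun j =>
    (List.finRange m).flatMap fun u => (List.finRange m).flatMap fun v =>
      if i = j then [] else
        if h : u = v then [] else [[(q i u, false), (q j v, false), (edge h, true)]]

/-- The clique part `Clique_{m,k}(x, q)`. [cite: Krajicek1997, §7] -/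
def cliqueCNF (m k c : ℕ) : CNF (Var m k c) :=
  cliquePos m k c ++ cliqueInj m k c ++ cliqueEdge m k c

/-! ### The colouring part `B(x, r)` -/

/-- Every vertex is coloured: `⋁_a r_{v,a}`. [cite: Krajicek1997, §7] -/
def colourPos (m k c : ℕ) : CNF (Var m k c) :=
  (List.finRange m).map fun v => (List.finRange c).map fun a => (r v a, true)

/-- Adjacent vertices get different colours: `¬r_{u,a} ∨ ¬r_{v,a} ∨ ¬x_{uv}` for `u ≠ v`
(edge variables NEGATIVE). [cite: Krajicek1997, §7] -/
def colourEdge (m k c : ℕ) : CNF (Var m k c) :=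
  (List.finRange m).flatMap fun u => (List.finRange m).flatMap fun v =>
    (List.finRange c).flatMap fun a =>
      if h : u = v then [] else [[(r u a, false), (r v a, false), (edge h, false)]]

/-- The colouring part `Colour_{m,c}(x, r)`. [cite: Krajicek1997, §7] -/
def colourCNF (m k c : ℕ) : CNF (Var m k c) :=
  colourPos m k c ++ colourEdge m k c

/-- The clique–colouring CNF `Clique_{m,k}(x,q) ∧ Colour_{m,c}(x,r)` (unsatisfiable for
`c < k`). [cite: Krajicek1997, §7] -/
def cliqueColourCNF (m k c : ℕ) : CNF (Var m k c) :=
  cliqueCNF m k c ++ colourCNF m k c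

/-! ### Shapes of the clauses -/

/-- Clauses of `cliquePos`. [folklore] -/
theorem mem_cliquePos {C : Clause (Var m k c)} (h : C ∈ cliquePos m k c) :
    ∃ i : Fin k, C = (List.finRange m).map fun v => (q i v, true) := by
  simp only [cliquePos, List.mem_map, List.mem_finRange, true_and] at h
  obtain ⟨i, rfl⟩ := h
  exact ⟨i, rfl⟩

/-- Clauses of `cliqueInj`. [folklore] -/
theorem mem_cliqueInj {C : Clause (Var m k c)} (h : C ∈ cliqueInj m k c) :
    ∃ i j : Fin k, ∃ v : Fin m, i ≠ j ∧ C = [(q i v, false), (q j v, false)] := by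
  simp only [cliqueInj, List.mem_flatMap, List.mem_finRange, true_and] at h
  obtain ⟨i, j, v, h⟩ := h
  by_cases hij : i = j
  · simp [hij] at h
  · simp only [hij, ↓reduceIte, List.mem_singleton] at h
    exact ⟨i, j, v, hij, h⟩

/-- Clauses of `cliqueEdge`. [folklore] -/
theorem mem_cliqueEdge {C : Clause (Var m k c)} (h : C ∈ cliqueEdge m k c) :
    ∃ i j : Fin k, ∃ u v : Fin m, ∃ huv : u ≠ v,
      i ≠ j ∧ C = [(q i u, false), (q j v, false), (edge huv, true)] := by
  simp only [cliqueEdge, List.mem_flatMap, List.mem_finRange, true_and] at h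
  obtain ⟨i, j, u, v, h⟩ := h
  by_cases hij : i = j
  · simp [hij] at h
  · by_cases huv : u = v
    · simp [hij, huv] at h
    · simp only [hij, ↓reduceIte, huv, ↓reduceDIte, List.mem_singleton] at h
      exact ⟨i, j, u, v, huv, hij, h⟩

/-- Clauses of `colourPos`. [folklore] -/
theorem mem_colourPos {C : Clause (Var m k c)} (h : C ∈ colourPos m k c) :
    ∃ v : Fin m, C = (List.finRange c).map fun a => (r v a, true) := by
  simp only [colourPos, List.mem_map, List.mem_finRange, true_and] at h
  obtain ⟨v, rfl⟩ := h
  exact ⟨v, rfl⟩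

/-- Clauses of `colourEdge`. [folklore] -/
theorem mem_colourEdge {C : Clause (Var m k c)} (h : C ∈ colourEdge m k c) :
    ∃ u v : Fin m, ∃ a : Fin c, ∃ huv : u ≠ v,
      C = [(r u a, false), (r v a, false), (edge huv, false)] := by
  simp only [colourEdge, List.mem_flatMap, List.mem_finRange, true_and] at h
  obtain ⟨u, v, a, h⟩ := h
  by_cases huv : u = v
  · simp [huv] at h
  · simp only [huv, ↓reduceDIte, List.mem_singleton] at h
    exact ⟨u, v, a, huv, h⟩

/-- The literals of the clique part: positive edge literals or `q`-literals.
[cite: Pudlak1997, §3] -/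
theorem literal_cliqueCNF {C : Clause (Var m k c)} (hC : C ∈ cliqueCNF m k c) {l : Literal (Var m k c)}
    (hl : l ∈ C) : (∃ e, l = (Sum.inl e, true)) ∨ ∃ i v b, l = (q i v, b) := by
  simp only [cliqueCNF, List.mem_append] at hC
  rcases hC with (hC | hC) | hC
  · obtain ⟨i, rfl⟩ := mem_cliquePos hC
    simp only [List.mem_map, List.mem_finRange, true_and] at hl
    obtain ⟨v, rfl⟩ := hl
    exact Or.inr ⟨i, v, true, rfl⟩
  · obtain ⟨i, j, v, -, rfl⟩ := mem_cliqueInj hC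
    simp only [List.mem_cons, List.not_mem_nil, or_false] at hl
    rcases hl with rfl | rfl
    · exact Or.inr ⟨i, v, false, rfl⟩
    · exact Or.inr ⟨j, v, false, rfl⟩
  · obtain ⟨i, j, u, v, huv, -, rfl⟩ := mem_cliqueEdge hC
    simp only [List.mem_cons, List.not_mem_nil, or_false] at hl
    rcases hl with rfl | rfl | rfl
    · exact Or.inr ⟨i, u, false, rfl⟩
    · exact Or.inr ⟨j, v, false, rfl⟩
    · exact Or.inl ⟨_, rfl⟩

/-- The literals of the colouring part: edge literals (negative) or `r`-literals.
[cite: Pudlak1997, §3] -/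
theorem literal_colourCNF {C : Clause (Var m k c)} (hC : C ∈ colourCNF m k c) {l : Literal (Var m k c)}
    (hl : l ∈ C) : (∃ e b, l = (Sum.inl e, b)) ∨ ∃ v a b, l = (r v a, b) := by
  simp only [colourCNF, List.mem_append] at hC
  rcases hC with hC | hC
  · obtain ⟨v, rfl⟩ := mem_colourPos hC
    simp only [List.mem_map, List.mem_finRange, true_and] at hl
    obtain ⟨a, rfl⟩ := hl
    exact Or.inr ⟨v, a, true, rfl⟩
  · obtain ⟨u, v, a, huv, rfl⟩ := mem_colourEdge hC
    simp only [List.mem_cons, List.not_mem_nil, or_false] at hl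
    rcases hl with rfl | rfl | rfl
    · exact Or.inr ⟨u, a, false, rfl⟩
    · exact Or.inr ⟨v, a, false, rfl⟩
    · exact Or.inl ⟨_, false, rfl⟩

/-! ### Positive test graphs satisfy the clique part -/

/-- A clause is true as soon as one of its literals is. [folklore] -/
theorem clause_eval_of_mem {ν : Type*} {σ : ν → Bool} {C : Clause ν} {l : Literal ν} (hl : l ∈ C)
    (h : l.eval σ = true) : C.eval σ = true :=
  List.any_eq_true.2 ⟨l, hl, h⟩

/-- **The clique vector of a `k`-set satisfies `Clique_{m,k}`**: put the `i`-th smallest element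
of `S` at position `i`. [cite: Krajicek1997, §7] -/
theorem cliqueCNF_satOver_cliqueVec (S : Finset (Fin m)) (hS : S.card = k) :
    ∃ σ : Var m k c → Bool, (∀ e, σ (Sum.inl e) = cliqueVec S e) ∧ (cliqueCNF m k c).eval σ = true := by
  classical
  let f : Fin k ↪o Fin m := S.orderEmbOfFin hS
  let σ : Var m k c → Bool := fun w =>
    match w with
    | Sum.inl e => cliqueVec S e
    | Sum.inr (Sum.inl (i, v)) => decide (f i = v)
    | Sum.inr (Sum.inr _) => false
  have hq : ∀ i v, σ (q i v) = decide (f i = v) := fun _ _ => rfl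
  refine ⟨σ, fun _ => rfl, ?_⟩
  rw [CNF.eval_eq_true_iff]
  intro C hC
  simp only [cliqueCNF, List.mem_append] at hC
  rcases hC with (hC | hC) | hC
  · obtain ⟨i, rfl⟩ := mem_cliquePos hC
    refine clause_eval_of_mem (l := (q i (f i), true)) (List.mem_map.2 ⟨f i, List.mem_finRange _, rfl⟩) ?_
    simp [Literal.eval, hq]
  · obtain ⟨i, j, v, hij, rfl⟩ := mem_cliqueInj hC
    by_cases hi : f i = v
    · have hj : f j ≠ v := fun hj => hij (f.injective (hi.trans hj.symm))
      exact clause_eval_of_mem (l := (q j v, false)) (by simp) (by simp [Literal.eval, hq, hj])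
    · exact clause_eval_of_mem (l := (q i v, false)) (by simp) (by simp [Literal.eval, hq, hi])
  · obtain ⟨i, j, u, v, huv, hij, rfl⟩ := mem_cliqueEdge hC
    by_cases hi : f i = u
    · by_cases hj : f j = v
      · refine clause_eval_of_mem (l := (edge huv, true)) (by simp) ?_
        have hu : u ∈ S := hi ▸ S.orderEmbOfFin_mem hS i
        have hv : v ∈ S := hj ▸ S.orderEmbOfFin_mem hS j
        simp only [Literal.eval, edge, beq_true]
        show cliqueVec S _ = true
        simp [cliqueVec, hu, hv]
      · exact clause_eval_of_mem (l := (q j v, false)) (by simp) (by simp [Literal.eval, hq, hj])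
    · exact clause_eval_of_mem (l := (q i u, false)) (by simp) (by simp [Literal.eval, hq, hi])

/-! ### Negative test graphs satisfy the colouring part -/

/-- **The colouring vector of a `c`-colouring satisfies `Colour_{m,c}`**: colour by `h` itself.
[cite: Krajicek1997, §7] -/
theorem colourCNF_satOver_colorVec (h : Fin m → Fin c) :
    ∃ σ : Var m k c → Bool, (∀ e, σ (Sum.inl e) = colorVec h e) ∧ (colourCNF m k c).eval σ = true := by
  classical
  let σ : Var m k c → Bool := fun w =>
    match w with
    | Sum.inl e => colorVec h e
    | Sum.inr (Sum.inl _) => false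
    | Sum.inr (Sum.inr (v, a)) => decide (h v = a)
  have hr : ∀ v a, σ (r v a) = decide (h v = a) := fun _ _ => rfl
  refine ⟨σ, fun _ => rfl, ?_⟩
  rw [CNF.eval_eq_true_iff]
  intro C hC
  simp only [colourCNF, List.mem_append] at hC
  rcases hC with hC | hC
  · obtain ⟨v, rfl⟩ := mem_colourPos hC
    refine clause_eval_of_mem (l := (r v (h v), true)) (List.mem_map.2 ⟨h v, List.mem_finRange _, rfl⟩) ?_
    simp [Literal.eval, hr]
  · obtain ⟨u, v, a, huv, rfl⟩ := mem_colourEdge hC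
    by_cases hu : h u = a
    · by_cases hv : h v = a
      · refine clause_eval_of_mem (l := (edge huv, false)) (by simp) ?_
        simp only [Literal.eval, edge]
        show (colorVec h _ == false) = true
        simp [colorVec, hu, hv]
      · exact clause_eval_of_mem (l := (r v a, false)) (by simp) (by simp [Literal.eval, hr, hv])
    · exact clause_eval_of_mem (l := (r u a, false)) (by simp) (by simp [Literal.eval, hr, hu])

/-! ### Unsatisfiability (pigeonhole) -/

/-- **`Clique_{m,k} ∧ Colour_{m,c}` is unsatisfiable for `c < k`**: the `k` clique vertices are
distinct and pairwise adjacent, so they receive `k` distinct colours out of `c`.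
[cite: Krajicek1997, §7] -/
theorem cliqueColourCNF_not_satisfiable (hck : c < k) : ¬ (cliqueColourCNF m k c).Satisfiable := by
  classical
  rintro ⟨σ, hσ⟩
  rw [CNF.eval_eq_true_iff] at hσ
  have hmem : ∀ C, C ∈ cliquePos m k c ∨ C ∈ cliqueInj m k c ∨ C ∈ cliqueEdge m k c ∨
      C ∈ colourPos m k c ∨ C ∈ colourEdge m k c → C.eval σ = true := fun C h =>
    hσ C (by simp only [cliqueColourCNF, cliqueCNF, colourCNF, List.mem_append]; tauto)
  -- positions ↦ vertices
  have hpos : ∀ i : Fin k, ∃ v : Fin m, σ (q i v) = true := fun i => by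
    have h := hmem _ (Or.inl (List.mem_map.2 ⟨i, List.mem_finRange _, rfl⟩))
    obtain ⟨l, hl, hle⟩ := List.any_eq_true.1 h
    simp only [List.mem_map, List.mem_finRange, true_and] at hl
    obtain ⟨v, rfl⟩ := hl
    exact ⟨v, by simpa [Literal.eval] using hle⟩
  choose f hf using hpos
  -- vertices ↦ colours
  have hcol : ∀ v : Fin m, ∃ a : Fin c, σ (r v a) = true := fun v => by
    have h := hmem _ (Or.inr (Or.inr (Or.inr (Or.inl (List.mem_map.2 ⟨v, List.mem_finRange _, rfl⟩)))))
    obtain ⟨l, hl, hle⟩ := List.any_eq_true.1 h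
    simp only [List.mem_map, List.mem_finRange, true_and] at hl
    obtain ⟨a, rfl⟩ := hl
    exact ⟨a, by simpa [Literal.eval] using hle⟩
  choose g hg using hcol
  -- pigeonhole on `i ↦ g (f i) : Fin k → Fin c`
  obtain ⟨i, j, hij, hgij⟩ := Fintype.exists_ne_map_eq_of_card_lt (fun i => g (f i)) (by simpa using hck)
  -- `f i ≠ f j` by the injectivity clauses
  have hfij : f i ≠ f j := by
    intro hfe
    have hC : [(q i (f i), false), (q j (f i), false)] ∈ cliqueInj m k c := by
      simp only [cliqueInj, List.mem_flatMap, List.mem_finRange, true_and]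
      exact ⟨i, j, f i, by simp [hij]⟩
    have h := hmem _ (Or.inr (Or.inl hC))
    have hqj : σ (q j (f i)) = true := by rw [hfe]; exact hf j
    simp [Clause.eval, Literal.eval, hf i, hqj] at h
  -- the edge `f i – f j` is on by the clique clauses …
  have hE : σ (edge hfij) = true := by
    have hC : [(q i (f i), false), (q j (f j), false), (edge hfij, true)] ∈ cliqueEdge m k c := by
      simp only [cliqueEdge, List.mem_flatMap, List.mem_finRange, true_and]
      exact ⟨i, j, f i, f j, by simp [hij, hfij]⟩
    have h := hmem _ (Or.inr (Or.inr (Or.inl hC)))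
    simpa [Clause.eval, Literal.eval, hf i, hf j] using h
  -- … and off by the colouring clauses
  have hC : [(r (f i) (g (f i)), false), (r (f j) (g (f i)), false), (edge hfij, false)] ∈ colourEdge m k c := by
    simp only [colourEdge, List.mem_flatMap, List.mem_finRange, true_and]
    exact ⟨f i, f j, g (f i), by simp [hfij]⟩
  have h := hmem _ (Or.inr (Or.inr (Or.inr (Or.inr hC))))
  have hgj : σ (r (f j) (g (f i))) = true := by rw [hgij]; exact hg (f j)
  simp [Clause.eval, Literal.eval, hg (f i), hgj, hE] at h

/-! ### Size -/

/-- A `flatMap` whose pieces have bounded length. [folklore] -/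
theorem length_flatMap_le {α β : Type*} (l : List α) (f : α → List β) {n : ℕ}
    (h : ∀ a ∈ l, (f a).length ≤ n) : (l.flatMap f).length ≤ l.length * n := by
  induction l with
  | nil => simp
  | cons a l ih =>
    rw [List.flatMap_cons, List.length_append, List.length_cons, Nat.succ_mul, add_comm (l.length * n)]
    exact Nat.add_le_add (h a (by simp)) (ih fun b hb => h b (by simp [hb]))

/-- **Polynomial size**: the clique–colouring CNF has at most `k + k² m + k² m² + m + m² c`
clauses. [cite: Krajicek1997, §7] -/
theorem length_cliqueColourCNF_le :
    (cliqueColourCNF m k c).length ≤ k + k ^ 2 * m + k ^ 2 * m ^ 2 + m + m ^ 2 * c := by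
  have h1 : (cliquePos m k c).length = k := by simp [cliquePos]
  have h2 : (cliqueInj m k c).length ≤ (List.finRange k).length *
      ((List.finRange k).length * ((List.finRange m).length * 1)) :=
    length_flatMap_le _ _ fun i _ => length_flatMap_le _ _ fun j _ =>
      length_flatMap_le _ _ fun v _ => by split_ifs <;> simp
  have h3 : (cliqueEdge m k c).length ≤ (List.finRange k).length *
      ((List.finRange k).length * ((List.finRange m).length * ((List.finRange m).length * 1))) :=
    length_flatMap_le _ _ fun i _ => length_flatMap_le _ _ fun j _ =>
      length_flatMap_le _ _ fun u _ => length_flatMap_le _ _ fun v _ => by split_ifs <;> simp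
  have h4 : (colourPos m k c).length = m := by simp [colourPos]
  have h5 : (colourEdge m k c).length ≤ (List.finRange m).length *
      ((List.finRange m).length * ((List.finRange c).length * 1)) :=
    length_flatMap_le _ _ fun u _ => length_flatMap_le _ _ fun v _ =>
      length_flatMap_le _ _ fun a _ => by split_ifs <;> simp
  simp only [List.length_finRange, mul_one] at h2 h3 h5
  simp only [cliqueColourCNF, cliqueCNF, colourCNF, List.length_append, h1, h4]
  nlinarith [h2, h3, h5]

end CliqueColouring

end Literature.Computability.MetaComplexity
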